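import Summits.BirchSwinnertonDyer.BirchSwinnertonDyer.Theorems.Rank1ResidualJetCarrierAddEndForm
import Summits.BirchSwinnertonDyer.BirchSwinnertonDyer.Theorems.Rank1ResidualJetKolyvaginLocalTermClosed
import HarnessLib

/-!
# T1 JET (cell `bsd-jet`), road K: the END FORMS at `p ∣ N` (K3, K3-add) of the kernel line WITHOUT the Kolyvagin-prime
# local term — `hloc` (Jetchev Lemma 5.2 (i) ∕ §3.2 (2)–(3)) is PROVED, not assumed

HONEST FRAMING (programme file `BSD-LIT2PART-PROGRAMME-v1.md` §HONESTY, verbatim): «no tranche here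
proves BSD; ARM L moves the LITERAL column of an r ≤ 1 census into the kernel-proved-modulo-named-print
column; ARM P changes what «named print» is worth.» THEOREMS ONLY (seat `bsd-jet-pv-1`, session g6;
`--supports stmt-BirchSwinnertonDyer-14418`, helper): no definition, no named fact, no `sorry`.
Nothing is booked; 0 classes move; the reading binders stay what they are.

## What

pv-2's end forms `jetchevDivisibilityCarrierMult_of_localFacts` (K3) and `…CarrierAdd…` (K3-add) derive the reading binders (Jetchev 2008 Thm. 1.4 ∕ Cor. 1.5 read at the
carrier) from CLOSED statements of four kinds: named print (`h52`, `hCV`, `hRCF`, `h44`, `hPT`, `h53`,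
`hGZ`), local print-to-type (`hloc`, `h𝒯σ`, `h𝒯sd`), the Kodaira–Néron datum `hΦ`, and the
completion-layer kernel gaps (`htr`, `h49str`). This file removes `hloc` from that list: it is a
THEOREM given `hPT` (`kolyvaginLocalTerm_of_poitouTate`, assembled from this session's bricks —
balanced involutions, the `ℚ`-Frobenius on `E[p^k]`, the decomposition group at `λ`,
`H¹_ur(K_λ, E[p^k]) ≅ E[p^k]` with `σ_{*,λ}` acting through the adapted lift, that lift being balanced,
Kummer = unramified + signed local duality). Remaining inputs: named print {`h52`, `hCV`, `hRCF`,
`h44`, `hPT`, `h53`, `hGZ`} · local print-to-type {`h𝒯σ`, `h𝒯sd`} · `hΦ` · kernel gaps {`htr`, `h49str`}.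

References (locators only; no cited FACT is declared): [cite: Jetchev2008, Thm. 1.4 / Cor. 1.5,
Thm. 5.2, Lemma 5.2, §3.2] [cite: McCallumLMS1991, Prop. 4.4, Prop. 5.2] [cite: GrossLMS1991, §3,
Prop. 5.3] [cite: GrossZagier1986, III (3.1)] [cite: Howard2004HeegnerKolyvagin, Prop. 2.1.7, 2.1.9,
Lemma 2.7.3] [cite: MilneADT2006, Ch. I, Thm. 4.10(b)]. Design: no definitions; signatures copied
verbatim from the end forms minus `hloc`. Axioms: `propext`, `Classical.choice`, `Quot.sound`.
-/

set_option autoImplicit false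

noncomputable section

open scoped Classical Pointwise

open WeierstrassCurve IsDedekindDomain NumberField Field Literature.NumberTheory.EllipticCurves
  Literature.NumberTheory.EllipticCurves.ModularForms Literature.NumberTheory.EllipticCurves.Jetchev2008
  Literature.NumberTheory.GaloisRepresentations Literature.NumberTheory.GaloisCohomology
  Literature.NumberTheory.GaloisRepresentations.DiscreteGaloisModule
  Summit.BirchSwinnertonDyer.Rank1Residual.X11b Summit.BirchSwinnertonDyer.Rank1Residual.X11b.Three
  Summit.BirchSwinnertonDyer.Rank1Residual.JET.SelmerVocabulary Literature.NumberTheory.Automorphic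

namespace Summit.BirchSwinnertonDyer.Rank1Residual.JET

/-- **`JetchevDivisibilityCarrierMult` ⟸ named print + `h𝒯σ`/`h𝒯sd` + carrier plumbing + the completion-layer gaps, with
the Kolyvagin-prime local term `hloc` NO LONGER AN INPUT** (K3: multiplicative carrier `p ∣ N`): the end form `jetchevDivisibilityCarrierMult_of_localFacts` (pv-2)
with its closed hypothesis `hloc` (Jetchev 2008 §3.2 (2)–(3) ∕ Lemma 5.2 (i)) DISCHARGED by
`kolyvaginLocalTerm_of_poitouTate hPT` (this seat, g6). All other hypotheses verbatim.
[cite: Jetchev2008, Thm. 1.4, Thm. 5.2, Lemma 5.2 (i), §3.2 (2)–(3)] [cite: McCallumLMS1991, Prop. 5.2]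
[cite: MilneADT2006, Ch. I, Thm. 4.10(b)] -/
theorem jetchevDivisibilityCarrierMult_of_localFacts_of_poitouTate
    -- NAMED PRINT
    (h52 : McCallum1991.prop52_exists_conductor_kolyvaginClass_order_eq)
    (hCV : JetchevCoreVertexExistence)
    (hRCF : ∀ (K : Type) [Field K] [NumberField K] (ι : K →+* ℂ), IsImaginaryQuadratic K →
      ∀ k : ℕ, NumberField (ringClassField K ι k))
    (h44 : McCallum1991.prop44_localOrder_kolyvaginClass_mul_eq)
    (hPT : ∀ (K : Type) [Field K] [NumberField K], poitouTate_selmerStructure_duality_conj K)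
    (h53 : ∀ (W : WeierstrassCurve ℚ) [W.IsElliptic] [NeZero (W.conductorNorm ℤ)]
      (K : Type) [Field K] [NumberField K]
      (Dt : ModularParametrizationData W (W.conductorNorm ℤ)) (β : ℤ) (ι : K →+* ℂ)
      [∀ j : ℕ, NumberField (ringClassField K ι j)],
      ∃ ε : ℤ, (ε = 1 ∨ ε = -1) ∧ ∀ (m : ℕ) (dm : KolyvaginHeegnerData Dt β ι m)
        (τm : ringClassField K ι m ≃ₐ[ℚ] ringClassField K ι m),
        (∀ x : ringClassField K ι m, ((τm x : ringClassField K ι m) : ℂ) = starRingEnd ℂ x) →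
        ∃ σ' ∈ ringClassGal ι m, IsOfFinAddOrder
          (pointGalHom W (ringClassField K ι m) τm dm.y -
            ε • pointGalHom W (ringClassField K ι m) σ' dm.y))
    (hGZ : ∀ (W : WeierstrassCurve ℚ) [W.IsElliptic] [NeZero (W.conductorNorm ℤ)]
      (K : Type) [Field K] [NumberField K] (p : ℕ) [Fact p.Prime]
      (Dt : ModularParametrizationData W (W.conductorNorm ℤ)) (β : ℤ) (ι : K →+* ℂ)
      [∀ j : ℕ, NumberField (ringClassField K ι j)],
      ∃ n' : ℤ, IsCoprime (p : ℤ) n' ∧ ∀ (m : ℕ) (dm : KolyvaginHeegnerData Dt β ι m)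
        (γ : ringClassField K ι m ≃ₐ[ℚ] ringClassField K ι m), γ ∈ ringClassGal ι m →
        ∀ v : HeightOneSpectrum (𝓞 K), ¬ (W.baseChange K).HasGoodReductionAt v →
          n' • pointsMap (W.baseChange K) (v.adicCompletion K)
              (dm.toGeomPoints (pointGalHom W (ringClassField K ι m) γ dm.y)) ∈
            E0Receptacle (W.baseChange K) v ∧
          ∀ (ℓ : ℕ), ℓ ∈ m.primeFactors → ∀ (dm' : KolyvaginHeegnerData Dt β ι (m / ℓ))
            (hle : ringClassField K ι (m / ℓ) ≤ ringClassField K ι m),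
            n' • pointsMap (W.baseChange K) (v.adicCompletion K)
                (dm.toGeomPoints (pointGalHom W (ringClassField K ι m) γ
                  (WeierstrassCurve.Affine.Point.map (W' := W)
                    ((RingClassField.inclusion ι hle).restrictScalars ℚ) dm'.y))) ∈
              E0Receptacle (W.baseChange K) v)
    -- LOCAL PRINT-TO-TYPE (`hloc` is now PROVED from `hPT`: `kolyvaginLocalTerm_of_poitouTate`)
    (h𝒯σ : ∀ (W : WeierstrassCurve ℚ) [W.IsElliptic] [W.IsGloballyMinimal]
      (K : Type) [Field K] [NumberField K], IsImaginaryQuadratic K →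
      ∀ (ι : K →+* ℂ) [∀ j : ℕ, NumberField (ringClassField K ι j)] (τ : K ≃ₐ[ℚ] K), τ ≠ 1 →
      ∀ (p k : ℕ) [Fact p.Prime], p ≠ 2 →
      ∀ (c : ℕ), Squarefree c → (∀ ℓ ∈ c.primeFactors,
        Zhang2014.IsKolyvaginPrime (W.conductorNorm ℤ) W K p ℓ ∧ k ≤ Zhang2014.kolyvaginIndex W p ℓ) →
      ∀ (𝒯 : SelmerStructure ((W.baseChange K).torsionGaloisModule ((p ^ k : ℕ) : ℤ))),
      (∀ v : HeightOneSpectrum (𝓞 K), 𝒯 (Sum.inr v) =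
        ⨅ ℓ ∈ c.primeFactors.filter (fun ℓ : ℕ ↦ ((ℓ : ℕ) : 𝓞 K) ∈ v.asIdeal),
          ⨅ (w' : HeightOneSpectrum (𝓞 (ringClassField K ι ℓ))) (_ : w'.asIdeal.LiesOver v.asIdeal),
            letI := (adicCompletionOfLiesOver K (ringClassField K ι ℓ) v w').toAlgebra
            transverseSubgroup (GaloisRep.toLocal v ((W.baseChange K).torsionGaloisModule ((p ^ k : ℕ) : ℤ)))
              (w'.adicCompletion (ringClassField K ι ℓ))) →
      ∀ (v w : HeightOneSpectrum (𝓞 K)) (h : τ • v = w), v ∈ placesDividing K c →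
      ∀ x : galoisCohomology (((W.baseChange K).torsionGaloisModule ((p ^ k : ℕ) : ℤ)).toLocal
        (Sum.inr v : Place K)) 1,
      x ∈ 𝒯 (Sum.inr v) → conjActPlace W τ ((p ^ k : ℕ) : ℤ) h x ∈ 𝒯 (Sum.inr w))
    (h𝒯sd : ∀ (W : WeierstrassCurve ℚ) [W.IsElliptic] [W.IsGloballyMinimal]
      (K : Type) [Field K] [NumberField K], IsImaginaryQuadratic K →
      ∀ (ι : K →+* ℂ) [∀ j : ℕ, NumberField (ringClassField K ι j)]
      (p k : ℕ) [Fact p.Prime] [NeZero (p ^ k)] [Finite (geomTorsion (W.baseChange K) ((p ^ k : ℕ) : ℤ))],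
      p ≠ 2 → ∀ (c : ℕ), Squarefree c → (∀ ℓ ∈ c.primeFactors,
        Zhang2014.IsKolyvaginPrime (W.conductorNorm ℤ) W K p ℓ ∧ k ≤ Zhang2014.kolyvaginIndex W p ℓ) →
      ∀ (𝒯 : SelmerStructure ((W.baseChange K).torsionGaloisModule ((p ^ k : ℕ) : ℤ))),
      (∀ v : HeightOneSpectrum (𝓞 K), 𝒯 (Sum.inr v) =
        ⨅ ℓ ∈ c.primeFactors.filter (fun ℓ : ℕ ↦ ((ℓ : ℕ) : 𝓞 K) ∈ v.asIdeal),
          ⨅ (w' : HeightOneSpectrum (𝓞 (ringClassField K ι ℓ))) (_ : w'.asIdeal.LiesOver v.asIdeal),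
            letI := (adicCompletionOfLiesOver K (ringClassField K ι ℓ) v w').toAlgebra
            transverseSubgroup (GaloisRep.toLocal v ((W.baseChange K).torsionGaloisModule ((p ^ k : ℕ) : ℤ)))
              (w'.adicCompletion (ringClassField K ι ℓ))) →
      ∀ (e : geomTorsion (W.baseChange K) ((p ^ k : ℕ) : ℤ) →
          geomTorsion (W.baseChange K) ((p ^ k : ℕ) : ℤ) → AlgebraicClosure K)
        (hμ : ∀ S T, e S T ^ (p ^ k) = 1)
        (hadd₁ : ∀ S₁ S₂ T, e (S₁ + S₂) T = e S₁ T * e S₂ T)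
        (hadd₂ : ∀ S T₁ T₂, e S (T₁ + T₂) = e S T₁ * e S T₂)
        (hgal : ∀ (g : absoluteGaloisGroup K) (S T : geomTorsion (W.baseChange K) ((p ^ k : ℕ) : ℤ)),
          g • e S T = e (g • S) (g • T)),
      (∀ T, e T T = 1) → (∀ T, (∀ S, e S T = 1) → T = 0) →
      ∀ inv : LocalInvariants K (p ^ k), inv.IsPerfect → ∀ v ∈ placesDividing K c,
      inv.dualTransported 𝒯 (weilDualIntertwining (W.baseChange K) (p ^ k) e hμ hadd₁ hadd₂ hgal)
        (Sum.inr v) = 𝒯 (Sum.inr v))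
    -- ROW / CARRIER datum (Kodaira–Néron)
    (hΦ : ∀ (W : WeierstrassCurve ℚ) [W.IsElliptic] [W.IsGloballyMinimal] (ℓ p : ℕ) [Fact ℓ.Prime]
      [Fact p.Prime], p ≠ 2 → p ∣ (W.baseChange ℚ_[ℓ]).localTamagawaNumber ℤ_[ℓ] →
      ∀ [(W.baseChange ℚ_[ℓ]).IsMinimal ℤ_[ℓ]],
      IsAddCyclic ((W.baseChange ℚ_[ℓ]).toAffine.Point ⧸ (W.baseChange ℚ_[ℓ]).goodReductionSubgroup ℤ_[ℓ]))
    -- the completion-layer KERNEL GAPS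
    (htr : ∀ (W : WeierstrassCurve ℚ) [W.IsElliptic] [W.IsGloballyMinimal] [NeZero (W.conductorNorm ℤ)]
      (K : Type) [Field K] [NumberField K], IsImaginaryQuadratic K →
      ∀ (p : ℕ) [Fact p.Prime], p ≠ 2 →
      ∀ (Dt : ModularParametrizationData W (W.conductorNorm ℤ)) (β : ℤ) (ι : K →+* ℂ)
        [∀ j : ℕ, NumberField (ringClassField K ι j)]
        (k : ℕ) (c : ℕ), Squarefree c →
        (∀ ℓ ∈ c.primeFactors, Zhang2014.IsKolyvaginPrime (W.conductorNorm ℤ) W K p ℓ ∧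
          k ≤ Zhang2014.kolyvaginIndex W p ℓ) →
      ∀ (d : KolyvaginHeegnerData Dt β ι c), ∀ ℓ ∈ c.primeFactors,
        (d.kolyvaginClass (Fact.out : p.Prime) k :
          galoisCohomology ((W.baseChange K).torsionGaloisModule ((p ^ k : ℕ) : ℤ)) 1) ∈
          transverseKer W K ι ((p ^ k : ℕ) : ℤ) ℓ)
    (h49str : ∀ (W : WeierstrassCurve ℚ) [W.IsElliptic] [W.IsGloballyMinimal] [NeZero (W.conductorNorm ℤ)]
      (K : Type) [Field K] [NumberField K], IsImaginaryQuadratic K →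
      SatisfiesHeegnerHypothesis (W.conductorNorm ℤ) K →
      ∀ (p : ℕ) [Fact p.Prime], p ≠ 2 →
      ∀ (Dt : ModularParametrizationData W (W.conductorNorm ℤ)) (β : ℤ) (ι : K →+* ℂ)
        [∀ j : ℕ, NumberField (ringClassField K ι j)]
        (k : ℕ) (hn : ((p ^ k : ℕ) : ℤ) ≠ 0) (c : ℕ), Squarefree c →
        (∀ ℓ ∈ c.primeFactors, Zhang2014.IsKolyvaginPrime (W.conductorNorm ℤ) W K p ℓ ∧
          k ≤ Zhang2014.kolyvaginIndex W p ℓ) →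
      ∀ (q : HeightOneSpectrum (𝓞 K)), ((W.conductorNorm ℤ : ℕ) : 𝓞 K) ∈ q.asIdeal →
      ∀ (ℓ : ℕ), Zhang2014.IsKolyvaginPrime (W.conductorNorm ℤ) W K p ℓ →
        k ≤ Zhang2014.kolyvaginIndex W p ℓ → ℓ ∉ c.primeFactors →
      ∀ (d' : KolyvaginHeegnerData Dt β ι (c * ℓ)),
        galoisCohomology.localization ((W.baseChange K).torsionGaloisModule ((p ^ k : ℕ) : ℤ))
            (Sum.inr q) 1 (d'.kolyvaginClass (Fact.out : p.Prime) k) ∈ stringentFamily W K hn (Sum.inr q)) :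
    JetchevDivisibilityCarrierMult :=
  jetchevDivisibilityCarrierMult_of_localFacts h52 hCV hRCF h44 hPT h53 hGZ (kolyvaginLocalTerm_of_poitouTate hPT) h𝒯σ h𝒯sd hΦ
    htr h49str

/-- **`JetchevDivisibilityCarrierAdd` ⟸ named print + `h𝒯σ`/`h𝒯sd` + carrier plumbing + the completion-layer gaps, with
the Kolyvagin-prime local term `hloc` NO LONGER AN INPUT** (K3-add: additive carrier `p ∣ N`): the end form `jetchevDivisibilityCarrierAdd_of_localFacts` (pv-2)
with its closed hypothesis `hloc` (Jetchev 2008 §3.2 (2)–(3) ∕ Lemma 5.2 (i)) DISCHARGED by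
`kolyvaginLocalTerm_of_poitouTate hPT` (this seat, g6). All other hypotheses verbatim.
[cite: Jetchev2008, Thm. 1.4, Thm. 5.2, Lemma 5.2 (i), §3.2 (2)–(3)] [cite: McCallumLMS1991, Prop. 5.2]
[cite: MilneADT2006, Ch. I, Thm. 4.10(b)] -/
theorem jetchevDivisibilityCarrierAdd_of_localFacts_of_poitouTate
    -- NAMED PRINT
    (h52 : McCallum1991.prop52_exists_conductor_kolyvaginClass_order_eq)
    (hCV : JetchevCoreVertexExistence)
    (hRCF : ∀ (K : Type) [Field K] [NumberField K] (ι : K →+* ℂ), IsImaginaryQuadratic K →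
      ∀ k : ℕ, NumberField (ringClassField K ι k))
    (h44 : McCallum1991.prop44_localOrder_kolyvaginClass_mul_eq)
    (hPT : ∀ (K : Type) [Field K] [NumberField K], poitouTate_selmerStructure_duality_conj K)
    (h53 : ∀ (W : WeierstrassCurve ℚ) [W.IsElliptic] [NeZero (W.conductorNorm ℤ)]
      (K : Type) [Field K] [NumberField K]
      (Dt : ModularParametrizationData W (W.conductorNorm ℤ)) (β : ℤ) (ι : K →+* ℂ)
      [∀ j : ℕ, NumberField (ringClassField K ι j)],
      ∃ ε : ℤ, (ε = 1 ∨ ε = -1) ∧ ∀ (m : ℕ) (dm : KolyvaginHeegnerData Dt β ι m)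
        (τm : ringClassField K ι m ≃ₐ[ℚ] ringClassField K ι m),
        (∀ x : ringClassField K ι m, ((τm x : ringClassField K ι m) : ℂ) = starRingEnd ℂ x) →
        ∃ σ' ∈ ringClassGal ι m, IsOfFinAddOrder
          (pointGalHom W (ringClassField K ι m) τm dm.y -
            ε • pointGalHom W (ringClassField K ι m) σ' dm.y))
    (hGZ : ∀ (W : WeierstrassCurve ℚ) [W.IsElliptic] [NeZero (W.conductorNorm ℤ)]
      (K : Type) [Field K] [NumberField K] (p : ℕ) [Fact p.Prime]
      (Dt : ModularParametrizationData W (W.conductorNorm ℤ)) (β : ℤ) (ι : K →+* ℂ)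
      [∀ j : ℕ, NumberField (ringClassField K ι j)],
      ∃ n' : ℤ, IsCoprime (p : ℤ) n' ∧ ∀ (m : ℕ) (dm : KolyvaginHeegnerData Dt β ι m)
        (γ : ringClassField K ι m ≃ₐ[ℚ] ringClassField K ι m), γ ∈ ringClassGal ι m →
        ∀ v : HeightOneSpectrum (𝓞 K), ¬ (W.baseChange K).HasGoodReductionAt v →
          n' • pointsMap (W.baseChange K) (v.adicCompletion K)
              (dm.toGeomPoints (pointGalHom W (ringClassField K ι m) γ dm.y)) ∈
            E0Receptacle (W.baseChange K) v ∧
          ∀ (ℓ : ℕ), ℓ ∈ m.primeFactors → ∀ (dm' : KolyvaginHeegnerData Dt β ι (m / ℓ))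
            (hle : ringClassField K ι (m / ℓ) ≤ ringClassField K ι m),
            n' • pointsMap (W.baseChange K) (v.adicCompletion K)
                (dm.toGeomPoints (pointGalHom W (ringClassField K ι m) γ
                  (WeierstrassCurve.Affine.Point.map (W' := W)
                    ((RingClassField.inclusion ι hle).restrictScalars ℚ) dm'.y))) ∈
              E0Receptacle (W.baseChange K) v)
    -- LOCAL PRINT-TO-TYPE (`hloc` is now PROVED from `hPT`: `kolyvaginLocalTerm_of_poitouTate`)
    (h𝒯σ : ∀ (W : WeierstrassCurve ℚ) [W.IsElliptic] [W.IsGloballyMinimal]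
      (K : Type) [Field K] [NumberField K], IsImaginaryQuadratic K →
      ∀ (ι : K →+* ℂ) [∀ j : ℕ, NumberField (ringClassField K ι j)] (τ : K ≃ₐ[ℚ] K), τ ≠ 1 →
      ∀ (p k : ℕ) [Fact p.Prime], p ≠ 2 →
      ∀ (c : ℕ), Squarefree c → (∀ ℓ ∈ c.primeFactors,
        Zhang2014.IsKolyvaginPrime (W.conductorNorm ℤ) W K p ℓ ∧ k ≤ Zhang2014.kolyvaginIndex W p ℓ) →
      ∀ (𝒯 : SelmerStructure ((W.baseChange K).torsionGaloisModule ((p ^ k : ℕ) : ℤ))),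
      (∀ v : HeightOneSpectrum (𝓞 K), 𝒯 (Sum.inr v) =
        ⨅ ℓ ∈ c.primeFactors.filter (fun ℓ : ℕ ↦ ((ℓ : ℕ) : 𝓞 K) ∈ v.asIdeal),
          ⨅ (w' : HeightOneSpectrum (𝓞 (ringClassField K ι ℓ))) (_ : w'.asIdeal.LiesOver v.asIdeal),
            letI := (adicCompletionOfLiesOver K (ringClassField K ι ℓ) v w').toAlgebra
            transverseSubgroup (GaloisRep.toLocal v ((W.baseChange K).torsionGaloisModule ((p ^ k : ℕ) : ℤ)))
              (w'.adicCompletion (ringClassField K ι ℓ))) →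
      ∀ (v w : HeightOneSpectrum (𝓞 K)) (h : τ • v = w), v ∈ placesDividing K c →
      ∀ x : galoisCohomology (((W.baseChange K).torsionGaloisModule ((p ^ k : ℕ) : ℤ)).toLocal
        (Sum.inr v : Place K)) 1,
      x ∈ 𝒯 (Sum.inr v) → conjActPlace W τ ((p ^ k : ℕ) : ℤ) h x ∈ 𝒯 (Sum.inr w))
    (h𝒯sd : ∀ (W : WeierstrassCurve ℚ) [W.IsElliptic] [W.IsGloballyMinimal]
      (K : Type) [Field K] [NumberField K], IsImaginaryQuadratic K →
      ∀ (ι : K →+* ℂ) [∀ j : ℕ, NumberField (ringClassField K ι j)]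
      (p k : ℕ) [Fact p.Prime] [NeZero (p ^ k)] [Finite (geomTorsion (W.baseChange K) ((p ^ k : ℕ) : ℤ))],
      p ≠ 2 → ∀ (c : ℕ), Squarefree c → (∀ ℓ ∈ c.primeFactors,
        Zhang2014.IsKolyvaginPrime (W.conductorNorm ℤ) W K p ℓ ∧ k ≤ Zhang2014.kolyvaginIndex W p ℓ) →
      ∀ (𝒯 : SelmerStructure ((W.baseChange K).torsionGaloisModule ((p ^ k : ℕ) : ℤ))),
      (∀ v : HeightOneSpectrum (𝓞 K), 𝒯 (Sum.inr v) =
        ⨅ ℓ ∈ c.primeFactors.filter (fun ℓ : ℕ ↦ ((ℓ : ℕ) : 𝓞 K) ∈ v.asIdeal),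
          ⨅ (w' : HeightOneSpectrum (𝓞 (ringClassField K ι ℓ))) (_ : w'.asIdeal.LiesOver v.asIdeal),
            letI := (adicCompletionOfLiesOver K (ringClassField K ι ℓ) v w').toAlgebra
            transverseSubgroup (GaloisRep.toLocal v ((W.baseChange K).torsionGaloisModule ((p ^ k : ℕ) : ℤ)))
              (w'.adicCompletion (ringClassField K ι ℓ))) →
      ∀ (e : geomTorsion (W.baseChange K) ((p ^ k : ℕ) : ℤ) →
          geomTorsion (W.baseChange K) ((p ^ k : ℕ) : ℤ) → AlgebraicClosure K)
        (hμ : ∀ S T, e S T ^ (p ^ k) = 1)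
        (hadd₁ : ∀ S₁ S₂ T, e (S₁ + S₂) T = e S₁ T * e S₂ T)
        (hadd₂ : ∀ S T₁ T₂, e S (T₁ + T₂) = e S T₁ * e S T₂)
        (hgal : ∀ (g : absoluteGaloisGroup K) (S T : geomTorsion (W.baseChange K) ((p ^ k : ℕ) : ℤ)),
          g • e S T = e (g • S) (g • T)),
      (∀ T, e T T = 1) → (∀ T, (∀ S, e S T = 1) → T = 0) →
      ∀ inv : LocalInvariants K (p ^ k), inv.IsPerfect → ∀ v ∈ placesDividing K c,
      inv.dualTransported 𝒯 (weilDualIntertwining (W.baseChange K) (p ^ k) e hμ hadd₁ hadd₂ hgal)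
        (Sum.inr v) = 𝒯 (Sum.inr v))
    -- ROW / CARRIER datum (Kodaira–Néron)
    (hΦ : ∀ (W : WeierstrassCurve ℚ) [W.IsElliptic] [W.IsGloballyMinimal] (ℓ p : ℕ) [Fact ℓ.Prime]
      [Fact p.Prime], p ≠ 2 → p ∣ (W.baseChange ℚ_[ℓ]).localTamagawaNumber ℤ_[ℓ] →
      ∀ [(W.baseChange ℚ_[ℓ]).IsMinimal ℤ_[ℓ]],
      IsAddCyclic ((W.baseChange ℚ_[ℓ]).toAffine.Point ⧸ (W.baseChange ℚ_[ℓ]).goodReductionSubgroup ℤ_[ℓ]))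
    -- the completion-layer KERNEL GAPS
    (htr : ∀ (W : WeierstrassCurve ℚ) [W.IsElliptic] [W.IsGloballyMinimal] [NeZero (W.conductorNorm ℤ)]
      (K : Type) [Field K] [NumberField K], IsImaginaryQuadratic K →
      ∀ (p : ℕ) [Fact p.Prime], p ≠ 2 →
      ∀ (Dt : ModularParametrizationData W (W.conductorNorm ℤ)) (β : ℤ) (ι : K →+* ℂ)
        [∀ j : ℕ, NumberField (ringClassField K ι j)]
        (k : ℕ) (c : ℕ), Squarefree c →
        (∀ ℓ ∈ c.primeFactors, Zhang2014.IsKolyvaginPrime (W.conductorNorm ℤ) W K p ℓ ∧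
          k ≤ Zhang2014.kolyvaginIndex W p ℓ) →
      ∀ (d : KolyvaginHeegnerData Dt β ι c), ∀ ℓ ∈ c.primeFactors,
        (d.kolyvaginClass (Fact.out : p.Prime) k :
          galoisCohomology ((W.baseChange K).torsionGaloisModule ((p ^ k : ℕ) : ℤ)) 1) ∈
          transverseKer W K ι ((p ^ k : ℕ) : ℤ) ℓ)
    (h49str : ∀ (W : WeierstrassCurve ℚ) [W.IsElliptic] [W.IsGloballyMinimal] [NeZero (W.conductorNorm ℤ)]
      (K : Type) [Field K] [NumberField K], IsImaginaryQuadratic K →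
      SatisfiesHeegnerHypothesis (W.conductorNorm ℤ) K →
      ∀ (p : ℕ) [Fact p.Prime], p ≠ 2 →
      ∀ (Dt : ModularParametrizationData W (W.conductorNorm ℤ)) (β : ℤ) (ι : K →+* ℂ)
        [∀ j : ℕ, NumberField (ringClassField K ι j)]
        (k : ℕ) (hn : ((p ^ k : ℕ) : ℤ) ≠ 0) (c : ℕ), Squarefree c →
        (∀ ℓ ∈ c.primeFactors, Zhang2014.IsKolyvaginPrime (W.conductorNorm ℤ) W K p ℓ ∧
          k ≤ Zhang2014.kolyvaginIndex W p ℓ) →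
      ∀ (q : HeightOneSpectrum (𝓞 K)), ((W.conductorNorm ℤ : ℕ) : 𝓞 K) ∈ q.asIdeal →
      ∀ (ℓ : ℕ), Zhang2014.IsKolyvaginPrime (W.conductorNorm ℤ) W K p ℓ →
        k ≤ Zhang2014.kolyvaginIndex W p ℓ → ℓ ∉ c.primeFactors →
      ∀ (d' : KolyvaginHeegnerData Dt β ι (c * ℓ)),
        galoisCohomology.localization ((W.baseChange K).torsionGaloisModule ((p ^ k : ℕ) : ℤ))
            (Sum.inr q) 1 (d'.kolyvaginClass (Fact.out : p.Prime) k) ∈ stringentFamily W K hn (Sum.inr q)) :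
    JetchevDivisibilityCarrierAdd :=
  jetchevDivisibilityCarrierAdd_of_localFacts h52 hCV hRCF h44 hPT h53 hGZ (kolyvaginLocalTerm_of_poitouTate hPT) h𝒯σ h𝒯sd hΦ
    htr h49str

end Summit.BirchSwinnertonDyer.Rank1Residual.JET

end
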